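import Literature.Computability.AlgebraicComplexity.AsymptoticSpectrumDuality
import Literature.Computability.AlgebraicComplexity.AsymptoticSubrankDuality
import Literature.Computability.AlgebraicComplexity.AsymptoticRankMatMul
import Literature.Computability.AlgebraicComplexity.MatMulMonomialSubrankAsymptotics
import Literature.Computability.AlgebraicComplexity.DegenerationSpectralMonotone
import Literature.Barriers.MatrixMultiplication.UniversalMethodBarrierAsymptoticRank
import Literature.Barriers.MatrixMultiplication.IrreversibilityBarrierThm19
import HarnessLib

/-!
# The converse door in the limit is D1 itself (given `ω = 2`)

Solo seat `solo-MatrixMultiplication-informed`, §2o(5) of the sharpest statement.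

Door D1 is `R̃(T_{cw,2}) = 3 ⟹ ω = 2`.  The *converse door* asks whether `ω = 2` forces
`R̃(T_{cw,2}) = 3`; the only mechanism in sight is an efficient embedding of Kronecker powers of
`T_{cw,2}` into matrix multiplication tensors, `T_{cw,2}^{⊠N} ≲ ⟨q,q,q⟩` with `q³ = 3^{3N/2}`
(flattening-tight).  `SoloInformedConverseDoorTwo` shows the level `N = 2` fails as a
DEGENERATION over every field (`⟨3,3,3⟩ ⋭ T_{cw,2} ⊠ T_{cw,2} ≅ perm₃`).  Here we settle the
ASYMPTOTIC form with Strassen's spectral theory (all of it proved in the tree: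
`IsStrassenPreorder.asympLe_iff_forall_spectralPoint`, `strassen_duality_asymptoticRank_holds`):

* `t ≲ s` = `AsympLe (· ≤ ·) [t] [s]` on the tensor semiring `T(K)`: `t^{⊠N}` is a restriction
  of `f(N) · s^{⊠N}` for a subexponential `f` (Zuiddam 2018, Def. 2.1) — unfolded in
  `asympLe_iff_restrictsTo`; the spectral characterisation `asympLe_iff_spectral`
  (`t ≲ s ↔ ∀ F ∈ Δ, F t ≤ F s`); restrictions and degenerations (`PolyDegeneratesTo`, Alman's
  form) are asymptotic restrictions.
* `sq_le_spectral_matMul` — `n² ≤ F ⟨n,n,n⟩` for every universal spectral point (`n ≥ 2`), from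
  the tree's `Q_M(⟨n,n,n⟩) ≥ n^{2-ε}` (Behrend / Ruzsa–Szemerédi).
* `asymptoticRank_cwTwo_pow_le` — `T_{cw,2}^{⊠N} ≲ ⟨q,q,q⟩ ⟹ R̃(T_{cw,2})^N ≤ q^ω`;
  `asymptoticRank_cwTwo_sq_le` — `perm₃ ≲ ⟨3,3,3⟩ ⟹ R̃(T_{cw,2})² ≤ 3^ω`, hence
  `R̃(T_{cw,2}) ≤ 3^{ω/2}` (`asymptoticRank_cwTwo_le_rpow`), which with `ω < 2.3716` would beat
  every known upper bound on `R̃(T_{cw,2})` (`< 3.931`, Alman–Li 2026).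
* `asympLe_of_asymptoticRank_cwTwo_le` — conversely `R̃(T_{cw,2}) ≤ 3 ⟹ perm₃ ≲ ⟨3,3,3⟩`
  unconditionally.
* `converseDoor_limit_iff` — **given `ω = 2`, `perm₃ ≲ ⟨3,3,3⟩ ↔ R̃(T_{cw,2}) = 3`**: the
  asymptotic converse door is EQUIVALENT to D1's hypothesis, so it cannot derive D1 from `ω = 2`.

References: V. Strassen, J. reine angew. Math. 384 (1988), Thm. 3.8; J. Zuiddam, PhD thesis
(2018), Thm. 2.12; M. Christandl, P. Vrana, J. Zuiddam, JAMS 36 (2023), Prop. 1.6; A. Conner,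
F. Gesmundo, J. M. Landsberg, E. Ventura, arXiv:1909.04785, Lemma 2.10 (`T_{cw,2}^{⊠2} ≅ perm₃`).
-/

noncomputable section

open scoped BigOperators Topology
open Filter

namespace Summit.MatrixMultiplication.MatrixMultiplication.Theorems.ConverseDoorLimit

open Literature.Computability.AlgebraicComplexity
open Literature.Barriers.MatrixMultiplication

variable {K : Type} [Field K]

/-! ## Asymptotic restriction -/

section Asymp

variable {ι κ μ ι' κ' μ' : Type} [Fintype ι] [Fintype κ] [Fintype μ] [Fintype ι'] [Fintype κ']
  [Fintype μ']

/-! `t ≲ s` ("`t` is an asymptotic restriction of `s`") is written throughout as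
`AsympLe (fun x y : TensorClass K => x ≤ y) (TensorClass.mk t) (TensorClass.mk s)`: the asymptotic
preorder (Zuiddam 2018, Def. 2.1: `[t]^N ≤ f(N) · [s]^N` for a subexponential `f`) of the
restriction order on the tensor semiring `T(K)` of the tree (`TensorSemiring.lean`). -/

/-- Unfolding: `t ≲ s` iff for a subexponential `f`, every `t^{⊠N}` is a restriction of
`⟨f(N)⟩ ⊠ s^{⊠N}` (= the direct sum of `f(N)` copies of `s^{⊠N}`). -/
theorem asympLe_iff_restrictsTo {s : ι → κ → μ → K} {t : ι' → κ' → μ' → K} :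
    AsympLe (fun x y : TensorClass K => x ≤ y) (TensorClass.mk t) (TensorClass.mk s) ↔
      ∃ f : ℕ → ℕ, IsSubexponential f ∧
      ∀ N, TensorRestrictsTo (kroneckerTensor (unitTensor K (f N)) (kroneckerPow s N))
        (kroneckerPow t N) := by
  unfold AsympLe
  refine exists_congr fun f => and_congr Iff.rfl (forall_congr' fun N => ?_)
  rw [TensorClass.mk_pow, TensorClass.mk_pow, TensorClass.natCast_eq_mk, TensorClass.mk_mul_mk]
  exact TensorClass.mk_le_mk_iff

/-- **Spectral characterisation** (Strassen's spectral theorem on `T(K)`, CVZ's dictionary between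
universal spectral points and monotone homomorphisms of `T(K)`): `t ≲ s ↔ F t ≤ F s` for every
universal spectral point `F`. -/
theorem asympLe_iff_spectral {s : ι → κ → μ → K} {t : ι' → κ' → μ' → K} :
    AsympLe (fun x y : TensorClass K => x ≤ y) (TensorClass.mk t) (TensorClass.mk s) ↔
      ∀ F, IsUniversalSpectralPoint K F → F t ≤ F s := by
  rw [(TensorClass.isStrassenPreorder K).asympLe_iff_forall_spectralPoint]
  constructor
  · intro H F hF
    have := H _ (TensorClass.isSpectralPoint_eval hF)
    rwa [TensorClass.eval_mk hF, TensorClass.eval_mk hF] at this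
  · intro H φ hφ
    have := H _ (TensorClass.isUniversalSpectralPoint_spectralMapOf hφ)
    rwa [TensorClass.spectralMapOf_apply, TensorClass.spectralMapOf_apply] at this

/-- A restriction is an asymptotic restriction. -/
theorem _root_.Literature.Computability.AlgebraicComplexity.TensorRestrictsTo.asympLe
    {s : ι → κ → μ → K} {t : ι' → κ' → μ' → K} (h : TensorRestrictsTo s t) :
    AsympLe (fun x y : TensorClass K => x ≤ y) (TensorClass.mk t) (TensorClass.mk s) :=
  asympLe_iff_spectral.2 fun _ hF => hF.mono _ _ h

omit [Fintype ι'] [Fintype κ'] [Fintype μ'] in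
/-- Alman's `PolyDegeneratesTo` (substitution matrices indexed source × target) is BCS's
degeneration `AlgDegeneratesTo` (target × source): transpose the three matrices. -/
theorem algDegeneratesTo_of_polyDegeneratesTo {s : ι → κ → μ → K} {t : ι' → κ' → μ' → K}
    (h : PolyDegeneratesTo s t) : AlgDegeneratesTo s t := by
  obtain ⟨h, A, B, C, hABC⟩ := h
  refine ⟨h, fun a' a => A a a', fun b' b => B b b', fun c' c => C c c', fun a' b' c' j hj => ?_⟩
  rw [← hABC a' b' c' j hj]
  congr 1
  refine Finset.sum_congr rfl fun a _ => Finset.sum_congr rfl fun b _ =>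
    Finset.sum_congr rfl fun c _ => ?_
  ring

/-- Universal spectral points are monotone under `PolyDegeneratesTo`. -/
theorem spectral_le_of_polyDegeneratesTo {F : SpectralMap K} (hF : IsUniversalSpectralPoint K F)
    {s : ι → κ → μ → K} {t : ι' → κ' → μ' → K} (h : PolyDegeneratesTo s t) : F t ≤ F s :=
  hF.mono_of_algDegeneratesTo (algDegeneratesTo_of_polyDegeneratesTo h)

/-- A degeneration is an asymptotic restriction. -/
theorem asympLe_of_polyDegeneratesTo {s : ι → κ → μ → K} {t : ι' → κ' → μ' → K}
    (h : PolyDegeneratesTo s t) :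
    AsympLe (fun x y : TensorClass K => x ≤ y) (TensorClass.mk t) (TensorClass.mk s) :=
  asympLe_iff_spectral.2 fun _ hF => spectral_le_of_polyDegeneratesTo hF h

end Asymp

/-! ## Every universal spectral point is at least `n²` on `⟨n,n,n⟩` -/

section MatMul

/-- `F ⟨R⟩ = R`. -/
theorem map_unitTensor {F : SpectralMap K} (hF : IsUniversalSpectralPoint K F) (n : ℕ) :
    F (unitTensor K n) = n := by
  rw [← TensorClass.evalRingHom_mk hF, ← TensorClass.natCast_eq_mk, map_natCast]

/-- `F ⟨n^L,n^L,n^L⟩ ≤ (F ⟨n,n,n⟩)^L` (in fact equal): `⟨n^L,n^L,n^L⟩` is a relabelling of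
`⟨n,n,n⟩^{⊠L}`. -/
theorem spectral_matMul_pow_le {F : SpectralMap K} (hF : IsUniversalSpectralPoint K F) (n L : ℕ) :
    F (matMulTensor K (n ^ L) (n ^ L) (n ^ L)) ≤ F (matMulTensor K n n n) ^ L := by
  rw [← hF.map_kroneckerPow]
  refine hF.mono _ _ ?_
  rw [matMulTensor_pow_eq_kroneckerPow_comp K n n n L]
  exact tensorRestrictsTo_precomp _ _ _ _

/-- `n^{2-ε} ≤ F ⟨n,n,n⟩` for `0 < ε ≤ 1`, `n ≥ 2`: for large `L`, `⟨n^L,n^L,n^L⟩ ≥ ⟨R⟩` with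
`R ≥ (n^L)^{2-ε}` (monomial subrank, Behrend), so `(n^{2-ε})^L ≤ F(⟨n,n,n⟩)^L`. -/
theorem rpow_le_spectral_matMul {F : SpectralMap K} (hF : IsUniversalSpectralPoint K F) {n : ℕ}
    (hn : 2 ≤ n) {ε : ℝ} (hε : 0 < ε) (hε1 : ε ≤ 1) :
    (n : ℝ) ^ (2 - ε) ≤ F (matMulTensor K n n n) := by
  obtain ⟨n₀, hn₀⟩ := exists_tensorMonRestrictsTo_matMulTensor_unitTensor K hε hε1
  set x := F (matMulTensor K n n n) with hx
  have hx0 : 0 ≤ x := hF.nonneg _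
  have hn0 : (0 : ℝ) ≤ n := Nat.cast_nonneg n
  have key : ∀ L : ℕ, n₀ ≤ n ^ L → ((n : ℝ) ^ (2 - ε)) ^ L ≤ x ^ L := by
    intro L hL
    obtain ⟨R, hR, hmon⟩ := hn₀ (n ^ L) hL
    have h2 : (R : ℝ) ≤ F (matMulTensor K (n ^ L) (n ^ L) (n ^ L)) := by
      rw [← map_unitTensor hF R]
      exact hF.mono _ _ hmon.tensorRestrictsTo
    have h3 : ((n : ℝ) ^ (2 - ε)) ^ L = (((n ^ L : ℕ) : ℝ)) ^ (2 - ε) := by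
      push_cast
      rw [← Real.rpow_natCast ((n : ℝ) ^ (2 - ε)) L, ← Real.rpow_mul hn0, mul_comm,
        Real.rpow_mul hn0, Real.rpow_natCast]
    rw [h3]
    exact hR.trans (h2.trans (spectral_matMul_pow_le hF n L))
  by_contra hlt
  rw [not_le] at hlt
  have h1n : 1 < n := by omega
  have hL : n₀ ≤ n ^ (n₀ + 1) := ((Nat.lt_pow_self h1n).le).trans' (Nat.le_succ n₀)
  have := key (n₀ + 1) hL
  exact absurd this (not_le.2 (pow_lt_pow_left₀ hlt hx0 (Nat.succ_ne_zero n₀)))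

/-- **`n² ≤ F ⟨n,n,n⟩`** for every universal spectral point `F` and `n ≥ 2` (the asymptotic
subrank of `⟨n,n,n⟩` is `n²`; Strassen 1988): let `ε → 0` in `rpow_le_spectral_matMul`. -/
theorem sq_le_spectral_matMul {F : SpectralMap K} (hF : IsUniversalSpectralPoint K F) {n : ℕ}
    (hn : 2 ≤ n) : (n : ℝ) ^ 2 ≤ F (matMulTensor K n n n) := by
  have hn0 : (0 : ℝ) < n := by exact_mod_cast (show 0 < n by omega)
  have hcont : ContinuousAt (fun ε : ℝ => (n : ℝ) ^ (2 - ε)) 0 :=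
    ContinuousAt.rpow continuousAt_const (continuousAt_const.sub continuousAt_id)
      (Or.inl hn0.ne')
  have ht : Tendsto (fun ε : ℝ => (n : ℝ) ^ (2 - ε)) (𝓝[>] 0) (𝓝 ((n : ℝ) ^ 2)) := by
    have := hcont.tendsto.mono_left (nhdsWithin_le_nhds (s := Set.Ioi (0 : ℝ)))
    simpa [Real.rpow_two] using this
  refine le_of_tendsto ht ?_
  filter_upwards [Ioo_mem_nhdsGT (zero_lt_one' ℝ)] with ε hε
  exact rpow_le_spectral_matMul hF hn hε.1 hε.2.le

/-- With `ω = 2` every universal spectral point takes the value `9 = 3^ω` on `⟨3,3,3⟩`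
(`9 ≤ F ≤ R̃(⟨3,3,3⟩) = 3^ω`). -/
theorem spectral_matMul_three_eq_nine (hω : omega K = 2) {F : SpectralMap K}
    (hF : IsUniversalSpectralPoint K F) : F (matMulTensor K 3 3 3) = 9 := by
  have h9 : (9 : ℝ) ≤ F (matMulTensor K 3 3 3) := by
    have := sq_le_spectral_matMul hF (n := 3) (by norm_num)
    norm_num at this
    exact this
  have hup := (strassen_duality_asymptoticRank_holds K (matMulTensor K 3 3 3)).1 F hF
  rw [asymptoticRank_matMulTensor K 3 (by norm_num), hω] at hup
  norm_num at hup
  exact le_antisymm hup h9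

end MatMul

/-! ## The converse door in the limit -/

section Door

/-- **`T_{cw,2}^{⊠N} ≲ ⟨q,q,q⟩ ⟹ R̃(T_{cw,2})^N ≤ q^ω`** (`q ≥ 1`): evaluate the universal
spectral point attaining `R̃(T_{cw,2})` (Strassen duality) and bound it on `⟨q,q,q⟩` by
`R̃(⟨q,q,q⟩) = q^ω`. -/
theorem asymptoticRank_cwTwo_pow_le {q : ℕ} (hq : 1 ≤ q) (N : ℕ)
    (h : AsympLe (fun x y : TensorClass K => x ≤ y)
      (TensorClass.mk (kroneckerPow (cwTensor K 2) N)) (TensorClass.mk (matMulTensor K q q q))) :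
    asymptoticRank (cwTensor K 2) ^ N ≤ (q : ℝ) ^ omega K := by
  obtain ⟨F, hF, hFt⟩ := (strassen_duality_asymptoticRank_holds K (cwTensor K 2)).2
  rw [← hFt, ← hF.map_kroneckerPow, ← asymptoticRank_matMulTensor K q hq]
  exact ((asympLe_iff_spectral.1 h) F hF).trans
    ((strassen_duality_asymptoticRank_holds K _).1 F hF)

/-- A fortiori for degenerations at a finite level:
`⟨q,q,q⟩ ⊵ T_{cw,2}^{⊠N} ⟹ R̃(T_{cw,2})^N ≤ q^ω`. -/
theorem asymptoticRank_cwTwo_pow_le_of_polyDegeneratesTo {q : ℕ} (hq : 1 ≤ q) (N : ℕ)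
    (h : PolyDegeneratesTo (matMulTensor K q q q) (kroneckerPow (cwTensor K 2) N)) :
    asymptoticRank (cwTensor K 2) ^ N ≤ (q : ℝ) ^ omega K :=
  asymptoticRank_cwTwo_pow_le hq N (asympLe_of_polyDegeneratesTo h)

/-- **`perm₃ ≲ ⟨3,3,3⟩ ⟹ R̃(T_{cw,2})² ≤ 3^ω`** (`perm₃ ≅ T_{cw,2} ⊠ T_{cw,2}`, CGLV Lemma 2.10). -/
theorem asymptoticRank_cwTwo_sq_le
    (h : AsympLe (fun x y : TensorClass K => x ≤ y)
      (TensorClass.mk (kroneckerTensor (cwTensor K 2) (cwTensor K 2)))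
      (TensorClass.mk (matMulTensor K 3 3 3))) :
    asymptoticRank (cwTensor K 2) ^ 2 ≤ (3 : ℝ) ^ omega K := by
  obtain ⟨F, hF, hFt⟩ := (strassen_duality_asymptoticRank_holds K (cwTensor K 2)).2
  have h1 := (asympLe_iff_spectral.1 h) F hF
  rw [hF.map_kronecker, hFt] at h1
  have h2 := (strassen_duality_asymptoticRank_holds K (matMulTensor K 3 3 3)).1 F hF
  rw [asymptoticRank_matMulTensor K 3 (by norm_num)] at h2
  push_cast at h2
  rw [sq]
  exact h1.trans h2

/-- Hence `perm₃ ≲ ⟨3,3,3⟩ ⟹ R̃(T_{cw,2}) ≤ 3^{ω/2}` (`< 3.68` with `ω < 2.3716`; the best known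
upper bound on `R̃(T_{cw,2})` is `3.93`). -/
theorem asymptoticRank_cwTwo_le_rpow
    (h : AsympLe (fun x y : TensorClass K => x ≤ y)
      (TensorClass.mk (kroneckerTensor (cwTensor K 2) (cwTensor K 2)))
      (TensorClass.mk (matMulTensor K 3 3 3))) :
    asymptoticRank (cwTensor K 2) ≤ (3 : ℝ) ^ (omega K / 2) := by
  have h2 := asymptoticRank_cwTwo_sq_le h
  have h0 : 0 ≤ asymptoticRank (cwTensor K 2) := asymptoticRank_nonneg _
  have h3 : (0 : ℝ) ≤ (3 : ℝ) ^ omega K := by positivity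
  calc asymptoticRank (cwTensor K 2)
      = (asymptoticRank (cwTensor K 2) ^ 2) ^ ((2 : ℕ) : ℝ)⁻¹ :=
        (Real.pow_rpow_inv_natCast h0 two_ne_zero).symm
    _ ≤ ((3 : ℝ) ^ omega K) ^ ((2 : ℕ) : ℝ)⁻¹ :=
        Real.rpow_le_rpow (pow_nonneg h0 2) h2 (by positivity)
    _ = (3 : ℝ) ^ (omega K / 2) := by
        rw [← Real.rpow_mul (by norm_num : (0 : ℝ) ≤ 3)]
        norm_num [div_eq_mul_inv]

/-- **`R̃(T_{cw,2}) ≤ 3 ⟹ perm₃ ≲ ⟨3,3,3⟩`**, unconditionally: every universal spectral point has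
`F(T_{cw,2})² ≤ R̃(T_{cw,2})² ≤ 9 ≤ F(⟨3,3,3⟩)`. -/
theorem asympLe_of_asymptoticRank_cwTwo_le (h : asymptoticRank (cwTensor K 2) ≤ 3) :
    AsympLe (fun x y : TensorClass K => x ≤ y)
      (TensorClass.mk (kroneckerTensor (cwTensor K 2) (cwTensor K 2)))
      (TensorClass.mk (matMulTensor K 3 3 3)) := by
  refine asympLe_iff_spectral.2 fun F hF => ?_
  rw [hF.map_kronecker]
  have h1 : F (cwTensor K 2) ≤ 3 := ((strassen_duality_asymptoticRank_holds K _).1 F hF).trans h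
  have h0 : 0 ≤ F (cwTensor K 2) := hF.nonneg _
  have h9 : (9 : ℝ) ≤ F (matMulTensor K 3 3 3) := by
    have := sq_le_spectral_matMul hF (n := 3) (by norm_num)
    norm_num at this
    exact this
  nlinarith

/-- `3 ≤ R̃(T_{cw,2})` over every field (flattening rank). -/
theorem three_le_asymptoticRank_cwTwo : (3 : ℝ) ≤ asymptoticRank (cwTensor K 2) := by
  have := flatteningRank_le_asymptoticRank (cwTensor K 2)
  rw [flatteningRank_cwTensor (K := K) (by norm_num : 1 ≤ 2)] at this
  exact_mod_cast this

/-- **THE CONVERSE DOOR IN THE LIMIT IS D1.** Given `ω = 2`: `perm₃ ≲ ⟨3,3,3⟩` (the Kronecker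
square of the door tensor is an asymptotic restriction of `3 × 3` matrix multiplication — the
flattening-tight format) **iff** `R̃(T_{cw,2}) = 3`, the hypothesis of door D1. -/
theorem converseDoor_limit_iff (hω : omega K = 2) :
    AsympLe (fun x y : TensorClass K => x ≤ y)
        (TensorClass.mk (kroneckerTensor (cwTensor K 2) (cwTensor K 2)))
        (TensorClass.mk (matMulTensor K 3 3 3)) ↔
      asymptoticRank (cwTensor K 2) = 3 := by
  constructor
  · intro h
    have h1 := asymptoticRank_cwTwo_sq_le h
    rw [hω] at h1
    norm_num at h1
    have h3 := three_le_asymptoticRank_cwTwo (K := K)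
    nlinarith
  · intro h
    exact asympLe_of_asymptoticRank_cwTwo_le h.le

/-- The same with the summit constant: `Summit.MatrixMultiplication` (`ω_ℂ = 2`) makes the
asymptotic converse door equivalent to D1's hypothesis `R̃(T_{cw,2}) = 3`. -/
theorem converseDoor_limit_iff_of_summit
    (hω : Literature.Computability.AlgebraicComplexity.MatrixMultiplication) :
    AsympLe (fun x y : TensorClass ℂ => x ≤ y)
        (TensorClass.mk (kroneckerTensor (cwTensor ℂ 2) (cwTensor ℂ 2)))
        (TensorClass.mk (matMulTensor ℂ 3 3 3)) ↔
      asymptoticRank (cwTensor ℂ 2) = 3 :=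
  converseDoor_limit_iff hω

end Door

end Summit.MatrixMultiplication.MatrixMultiplication.Theorems.ConverseDoorLimit

end
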